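import Mathlib
import Summits.QuantumFields.BalabanUV.Beta.DecouplingResummation110

/-!
# [Balaban1988RG2Cluster] p. 4 ∕ p. 11: the SUPPORT of the decorated terms — «depends on propagators and function B, s
# restricted to the component Y₀» DERIVED from the p. 3 definition of the `s`-decoration (walks weighted by
# `s(Δ₁)⋯s(Δ_m)`) for the three non-local term types T3, T5, T6 of [Balaban1987RG1] (2.12), and hence (1.9) = (1.10)
# for them BY NAME (cell topic `Summits/QuantumFields/BalabanUV/Beta`; row-D4 terminal leaf (T4)(b), caveat C1)

HONEST FRAMING (cell rule).  Discharging `BetaPertH` makes Bałaban's UV stability UNCONDITIONAL — a real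
constructive-QFT result; NOT the continuum limit, NOT the Clay problem.  This module discharges NOTHING of `BetaPertH`.
It is the row-D4 owner's kernel form of the SUPPORT half of [II] Lemma 2's sentence *"it can be done in the same way
for all terms in 𝐏^{(k)}"* for the non-local D̃-carrying terms T3, T5, T6 (the BOUND half is this lineage's
`PkDecoupledTerms`, p200923, whose NOT-CLAIMED list names exactly «the support∕locality statement of (1.10) for the
decoupled terms»; census `BETA/REMAINDER-BETA.md` §10.9.1 caveat C1 «the ASSEMBLED support statement (1.10) for
T3∕T5∕T6 … the one prose item not in kernel»).  [folklore] finite-sum support calculus composed BY NAME with the sibling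
module `DecouplingResummation110` (the resummation (1.9) = (1.10) in the Cauchy representation (1.23)) and with the
wall-component geometry of `B14Components`∕`B13Factor210`; NOT summit progress.  Unit `b2b-balaban-beta-an4-g34`
(owner of `BINDER-OWNERS.md` row D4); cell `GAPS.md` C-an4-66.

CITATION HEADER (lean-in-tree rule).  [II] = T. Bałaban, *Renormalization group approach to lattice gauge field
theories. II. Cluster expansions*, Commun. Math. Phys. **116**, 1–22 (1988) [Balaban1988RG2Cluster] (journal page =
PDF page; renders `HOME/b2b-balaban-ref1/pages/1988-cmp116-rg-II-cluster/…-p003-x2.png`, `…-p004-x2.png`,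
`…-p010-x2.png`, `…-p011-x2.png`, READ AS IMAGES by this unit); [I] = T. Bałaban, *… I. Generation of effective actions
in a small field approximation and a coupling constant renormalization in four dimensions*, Commun. Math. Phys. **109**,
249–301 (1987) [Balaban1987RG1] (render `…1987-cmp109-rg-I-small-field-p020-x2.png`, p. 268, read as an image).
WHAT IS REPRODUCED — [II] p. 3 [PDF 3], verbatim (the DEFINITION of the decoration): *"A propagator is represented by
the sum (3.107) [13] Σ_ω R₀(X₀)R_{α₁}(X₁)⋯R_{αₙ}(Xₙ), (1.6) where ω = ((0, X₀)(α₁, X₁), …, (αₙ, Xₙ)), X₀, X₁, …, Xₙ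
are simple localization domains, unions of connected families containing several cubes from π_k(1), i.e. of the size
M₁ instead of M. … Each factor in (6.6) depends on external gauge field configurations restricted to the corresponding
domain X̃ⱼ⁵, and its kernel vanishes in a sufficiently thick neighborhood of ∂Xⱼ"* and *"To each cube Δ in this family
we assign a variable s(Δ), and we denote by s the system of all these variables. We introduce a dependence on s in
propagators in the following way: for a random walk ω localized in X̃₀⁵ ∪ X̃₁⁵ ∪ ⋯ ∪ X̃ₙ⁵ we take the {Δ₁, …, Δ_m} of
all cubes from σ₀ which intersect this localization domain, and we multiply the term in (1.6) corresponding to ω by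
s(Δ₁)⋯s(Δ_m). This way the s-dependent propagators H(s), G̃(s), H₀(s) are defined. They coincide with the original
ones for s = 1."*; [II] p. 4 [PDF 4], verbatim (the STATEMENT derived here): *"At first we remark that kernels of the
operators H(s), G̃(s), H₀(s) vanish, unless both arguments are in the interior of one component of Y(σ), in fact with
distances to the boundary of this component bigger than M₁."* … *"we obtain that the term in the sum on the right-hand
side of (1.9), corresponding to the set σ, depends on propagators and function B, s restricted to the component Y₀"*;
[II] p. 11 [PDF 11], verbatim: *"The above analysis was done on the example of the expression (1∕g_k²)V(H₁B′), but it
can be done in the same way for all terms in 𝐏^{(k)}(g_k, 𝐔, 𝐉, B), and we obtain the same decompositions and bounds,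
possibly with other absolute constants. In fact many of these terms are much simpler, and the above results can be
obtained applying the generalized random walk expansions directly, or even more elementary means."* (p. 10: the root of
(1.38) is one cube `□`, «localized in the interior of Y, with respect to 𝐔, 𝐉, B′ or B»); [I] (2.12) p. 268, the terms
(the decoration enters ONLY through `H₁`, `Δ₁` — READING of `PkDecoupledTerms`): T3 = `(1∕g_k²)⟨H₁hD̃₃(g_kCB), J⟩`,
T5 = `(1∕g_k²)⟨H₁g_kCB, Δ₁H₁hD̃(g_kCB)⟩`, T6 = `−(1∕g_k²)⟨H₁hD̃(g_kCB), Δ₁H₁hD̃(g_kCB)⟩`.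

WHAT IS CERTIFIED HERE (kernel, sorry-free; [folklore] finite-sum support calculus).
§1 SUPPORT CALCULUS for decorated kernels `H(τ) : Λ → Λ → 𝔸` (sites `Λ`, each in its M-cube `cube x : Pt d`;
   parameters `τ : Pt d → ℂ` vanishing off the live family `σ`, `VanishOff`): `BlockLocal cube H σ W` = the p. 4
   remark as a PREDICATE ((i) no entry from a site of `W` to a site outside `W`; (ii) entries inside `W` do not read the
   parameters of live cubes outside `W`); `FieldIdle`∕`ScalarIdle`; closure rules `fieldIdle_const` (undecorated
   fields), `fieldIdle_kapply` (block-local kernel applied to an idle field), `scalarIdle_pairing` (the `□`-localized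
   pairing `Σ_{x∈□} β(f x, g x)` of idle fields, `□`'s cubes in `W`).
§2 THE THREE SHAPES, localized in a cube `□` (the decomposition `1 = Σ ζ_□` of (1.37) applied to the site sum of the
   pairing): `T3loc`, `T5loc`, `T6loc` and `scalarIdle_T3loc∕T5loc∕T6loc` — idle off `W` as soon as `H₁(τ)`, `Δ₁(τ)`
   are block-local at `W` and `□`'s cubes lie in `W`.
§3 THE p. 4 REMARK DERIVED FROM THE p. 3 DEFINITION: for the `s`-weighted walk sum
   `walkSum R walks cubes ker τ x y = Σ_{ω∈walks} (∏_{Δ ∈ cubes ω ∖ R} τ Δ) • ker ω x y` (`weight` = the printed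
   `s(Δ₁)⋯s(Δ_m)` over the non-root cubes met by the walk; `ker ω` supported in the walk's cubes, `hsupp`; the cube
   family of each walk WALL-CONNECTED, `hconn`), **`blockLocal_walkSum`**: `BlockLocal cube (walkSum …) σ (rootComp R σ a₀)`
   for EVERY live family `σ` — a walk of non-zero weight at parameters vanishing off `σ` meets only cubes of `R ∪ σ`, so
   its (wall-connected) cube family lies in ONE component of `Y(σ)` (`cubes_subset_rootComp`, via the sibling's
   `subset_rootComp_of_wallConnected`); plus `walkSum_rootBlock_congr` (the rows of `H(s)` at the root component do not
   change when the walk kernels are changed on walks NOT inside the root component — the abstract form of «depends on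
   𝐔, 𝐉 restricted to Y₀», p. 5 ll. 1–3, the kernels being the carriers of the configuration dependence, p. 3).
§4 THE END: `supportedOnRootComp_T3loc∕T5loc∕T6loc` — the sibling's support hypothesis `SupportedOnRootComp` HOLDS for
   the `□`-pieces of T3, T5, T6 with walk-decorated `H₁`, `Δ₁`, root family `R ∋ a₀` wall-connected, `□`'s cubes in `R`;
   hence **`sum_term19_T5loc_eq_sum_connected`**: (1.9) = (1.10) for T5 BY NAME (`sum_term19_eq_sum_connected`), the T3∕T6
   instances being the same one-line composition.

NOT CLAIMED (located, by name).  The dictionary: that the complexified `H₁(σ(Y))`, `Δ₁(σ(Y))` of (1.38) ARE such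
decorated walk sums (FINITE families here — a model convention; print's (1.6) is a convergent series, [13] (3.107)–(3.108)),
with `cubes ω` = the M-cubes containing a site of the walk's domain `X̃₀⁵ ∪ ⋯ ∪ X̃ₙ⁵` (partition semantics for «intersect»),
wall-connected because that domain is a connected union of M₁-cubes nested in M-cubes (`R₁M₁M⁻¹ ≦ 1`, p. 3; device
`B13Factor210Literal.cubeIdx_wallAdjacent`, not composed); the «distances bigger than M₁» refinement of p. 4 (not needed);
the `𝐇_k`-term of Lemma 1 (needs the fixed-point locality of (1.3)–(1.5), tree `B13PkLocalTerms`, not composed); the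
terms T1, T2 (strictly local, `B13PkLocalTerms`), T4 (G₃, `GaugeFixingCubic266`), T7 (the printed example); (1.9) itself
and «(1.23) = the s-derivatives» (the sibling's NOT-CLAIMED (a)); every BOUND; NOT summit progress.  MODEL CONVENTIONS:
kernel entries in a semiring `𝔸` with `ℂ`-action (in print `End 𝔤ᶜ`-valued), fields in an `𝔸`-module `M` (`kapply`,
finite volume `Fintype Λ`), pairing any biadditive `β : M →+ M →+ E`; the prefactors `±1∕g_k²` of (2.12) dropped.
v1.0.1 (same unit, DOCFIX after XREAD gan24-formalise-leaf-03-g9, journal l.4081 ∕ cell `GAPS.md` C-gan24leaf03-g9-3 D1):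
docstring-only — the quotation in the docstring of `weight` is now the printed p. 3 span; v1 carried there, inside quotation
marks, a paraphrase inherited from `B13GaugeDevices`' docstring of `Cov.walkSum`.  No statement, proof or name changed.
-/

namespace Summit.QuantumFields.BalabanUV.Beta.DecouplingSupport110

open Literature.MathematicalPhysics.QuantumFieldTheory.Balaban1983to89.B14DomainGeom (Pt)
open Literature.MathematicalPhysics.QuantumFieldTheory.Balaban1983to89.B13Factor210 (WallConnected)
open Summit.QuantumFields.BalabanUV.Beta.DecouplingResummation110 (rootComp mem_rootComp subset_rootComp
  subset_rootComp_of_wallConnected SupportedOnRootComp term19 sum_term19_eq_sum_connected)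

noncomputable section

variable {d : ℕ} {Λ : Type*}

/-! ## §1 Support calculus for decorated kernels and fields -/

/-- Parameter vectors vanishing off the live family `σ` («s(σᶜ) = 0» in (1.9)). [folklore] -/
def VanishOff (σ : Finset (Pt d)) (τ : Pt d → ℂ) : Prop := ∀ Δ, Δ ∉ σ → τ Δ = 0

/-- Updating a LIVE coordinate keeps a vector vanishing off `σ`. [folklore] -/
theorem VanishOff.update {σ : Finset (Pt d)} {τ : Pt d → ℂ} (hτ : VanishOff σ τ) {Δ' : Pt d} (hΔ' : Δ' ∈ σ)
    (z : ℂ) : VanishOff σ (Function.update τ Δ' z) := by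
  intro Δ hΔ
  have hne : Δ ≠ Δ' := fun h => hΔ (h ▸ hΔ')
  rw [Function.update_of_ne hne]
  exact hτ Δ hΔ

/-- A DECORATED KERNEL `H(τ)` (an `s`-decorated propagator, [II] p. 3) is BLOCK-LOCAL at the cube family `W` for the
live family `σ`: for parameters vanishing off `σ`, (i) no kernel entry leads from a site of `W` to a site outside `W`,
and (ii) the entries between sites of `W` do not depend on the parameters of live cubes outside `W` — [II] p. 4:
*"kernels of the operators H(s), G̃(s), H₀(s) vanish, unless both arguments are in the interior of one component of
Y(σ)"* and (the operator) *"restricted to this component"* depends on *"s, restricted to this component"*.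
`cube x` is the M-cube of the site `x`. [cite: Balaban1988RG2Cluster, p.4 before (1.10)] -/
structure BlockLocal {𝔸 : Type*} [Zero 𝔸] (cube : Λ → Pt d) (H : (Pt d → ℂ) → Λ → Λ → 𝔸) (σ W : Finset (Pt d)) :
    Prop where
  off : ∀ τ, VanishOff σ τ → ∀ x y, cube x ∈ W → cube y ∉ W → H τ x y = 0
  idle : ∀ τ, VanishOff σ τ → ∀ Δ' ∈ σ, Δ' ∉ W → ∀ (z : ℂ) x y, cube x ∈ W → cube y ∈ W →
    H (Function.update τ Δ' z) x y = H τ x y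

/-- A DECORATED FIELD `f(τ)` is IDLE OFF `W`: its values at the sites of `W` do not depend on the parameters of live
cubes outside `W`. [folklore] -/
def FieldIdle {M : Type*} (cube : Λ → Pt d) (f : (Pt d → ℂ) → Λ → M) (σ W : Finset (Pt d)) : Prop :=
  ∀ τ, VanishOff σ τ → ∀ Δ' ∈ σ, Δ' ∉ W → ∀ (z : ℂ) x, cube x ∈ W → f (Function.update τ Δ' z) x = f τ x

/-- A SCALAR functional `F(τ)` is IDLE OFF `W`: its value does not depend on the parameters of live cubes outside `W`.
[folklore] -/
def ScalarIdle {N : Type*} (F : (Pt d → ℂ) → N) (σ W : Finset (Pt d)) : Prop :=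
  ∀ τ, VanishOff σ τ → ∀ Δ' ∈ σ, Δ' ∉ W → ∀ z : ℂ, F (Function.update τ Δ' z) = F τ

/-- An UNDECORATED field (`g_kCB`, `hD̃(g_kCB)`, `hD̃₃(g_kCB)`, `J` of [I] (2.12): no propagator, no parameter) is idle.
[folklore] -/
theorem fieldIdle_const {M : Type*} (cube : Λ → Pt d) (v : Λ → M) (σ W : Finset (Pt d)) :
    FieldIdle cube (fun _ => v) σ W :=
  fun _ _ _ _ _ _ _ _ => rfl

section Linear

variable [Fintype Λ] {𝔸 : Type*} [Semiring 𝔸] {M : Type*} [AddCommMonoid M] [Module 𝔸 M]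
  {N : Type*} [AddCommMonoid N]

/-- The action of a kernel on a field: `(K·v)(x) = Σ_y K(x, y) • v(y)`. [folklore] -/
def kapply (K : Λ → Λ → 𝔸) (v : Λ → M) : Λ → M := fun x => ∑ y, K x y • v y

/-- **APPLY**: a block-local decorated kernel applied to an idle field is an idle field. [folklore] -/
theorem fieldIdle_kapply {cube : Λ → Pt d} {H : (Pt d → ℂ) → Λ → Λ → 𝔸} {f : (Pt d → ℂ) → Λ → M}
    {σ W : Finset (Pt d)} (hH : BlockLocal cube H σ W) (hf : FieldIdle cube f σ W) :
    FieldIdle cube (fun τ => kapply (H τ) (f τ)) σ W := by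
  intro τ hτ Δ' hΔ'σ hΔ'W z x hx
  unfold kapply
  refine Finset.sum_congr rfl fun y _ => ?_
  by_cases hy : cube y ∈ W
  · rw [hH.idle τ hτ Δ' hΔ'σ hΔ'W z x y hx hy, hf τ hτ Δ' hΔ'σ hΔ'W z y hy]
  · rw [hH.off _ (hτ.update hΔ'σ z) x y hx hy, hH.off τ hτ x y hx hy, zero_smul, zero_smul]

omit [Fintype Λ] in
/-- **LOCALIZED PAIRING**: the pairing of two idle fields over the sites of a cube `□` whose M-cubes lie in `W`
(the `□`-localized piece `⟨·, 1_□ ·⟩` of an inner product) is an idle scalar. [folklore] -/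
theorem scalarIdle_pairing {cube : Λ → Pt d} (β : M →+ M →+ N) {f g : (Pt d → ℂ) → Λ → M} {σ W : Finset (Pt d)}
    (box : Finset Λ) (hbox : ∀ x ∈ box, cube x ∈ W) (hf : FieldIdle cube f σ W) (hg : FieldIdle cube g σ W) :
    ScalarIdle (fun τ => ∑ x ∈ box, β (f τ x) (g τ x)) σ W := by
  intro τ hτ Δ' hΔ'σ hΔ'W z
  refine Finset.sum_congr rfl fun x hx => ?_
  rw [hf τ hτ Δ' hΔ'σ hΔ'W z x (hbox x hx), hg τ hτ Δ' hΔ'σ hΔ'W z x (hbox x hx)]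

/-! ## §2 The three non-local term shapes T3, T5, T6 of [I] (2.12), localized in a cube `□` -/

/-- T3 localized in `□`: `Σ_{x∈□} β((H₁ u)(x), J(x))` — the `□`-piece of `⟨H₁hD̃₃(g_kCB), J⟩`, `u = hD̃₃(g_kCB)`.
[cite: Balaban1987RG1, (2.12) p.268] -/
def T3loc (β : M →+ M →+ N) (box : Finset Λ) (H₁ : (Pt d → ℂ) → Λ → Λ → 𝔸) (u J : Λ → M)
    (τ : Pt d → ℂ) : N :=
  ∑ x ∈ box, β (kapply (H₁ τ) u x) (J x)

/-- T5 localized in `□`: `Σ_{x∈□} β((H₁ v)(x), (Δ₁ H₁ w)(x))` — the `□`-piece of `⟨H₁g_kCB, Δ₁H₁hD̃(g_kCB)⟩`,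
`v = g_kCB`, `w = hD̃(g_kCB)`. [cite: Balaban1987RG1, (2.12) p.268] -/
def T5loc (β : M →+ M →+ N) (box : Finset Λ) (H₁ Δ₁ : (Pt d → ℂ) → Λ → Λ → 𝔸) (v w : Λ → M)
    (τ : Pt d → ℂ) : N :=
  ∑ x ∈ box, β (kapply (H₁ τ) v x) (kapply (Δ₁ τ) (kapply (H₁ τ) w) x)

/-- T6 localized in `□`: `Σ_{x∈□} β((H₁ w)(x), (Δ₁ H₁ w)(x))` — the `□`-piece of `⟨H₁hD̃(g_kCB), Δ₁H₁hD̃(g_kCB)⟩`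
= T5's shape with both fields equal to `w = hD̃(g_kCB)`. [cite: Balaban1987RG1, (2.12) p.268] -/
def T6loc (β : M →+ M →+ N) (box : Finset Λ) (H₁ Δ₁ : (Pt d → ℂ) → Λ → Λ → 𝔸) (w : Λ → M) : (Pt d → ℂ) → N :=
  T5loc β box H₁ Δ₁ w w

/-- T3's `□`-piece is idle off `W` when `H₁(τ)` is block-local at `W` and `□`'s cubes lie in `W`. [folklore] -/
theorem scalarIdle_T3loc {cube : Λ → Pt d} (β : M →+ M →+ N) {box : Finset Λ} {σ W : Finset (Pt d)}
    (hbox : ∀ x ∈ box, cube x ∈ W) {H₁ : (Pt d → ℂ) → Λ → Λ → 𝔸} (hH : BlockLocal cube H₁ σ W) (u J : Λ → M) :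
    ScalarIdle (T3loc β box H₁ u J) σ W :=
  scalarIdle_pairing β box hbox (fieldIdle_kapply hH (fieldIdle_const cube u σ W)) (fieldIdle_const cube J σ W)

/-- T5's `□`-piece is idle off `W` when `H₁(τ)`, `Δ₁(τ)` are block-local at `W` and `□`'s cubes lie in `W`.
[folklore] -/
theorem scalarIdle_T5loc {cube : Λ → Pt d} (β : M →+ M →+ N) {box : Finset Λ} {σ W : Finset (Pt d)}
    (hbox : ∀ x ∈ box, cube x ∈ W) {H₁ Δ₁ : (Pt d → ℂ) → Λ → Λ → 𝔸} (hH : BlockLocal cube H₁ σ W)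
    (hΔ : BlockLocal cube Δ₁ σ W) (v w : Λ → M) : ScalarIdle (T5loc β box H₁ Δ₁ v w) σ W :=
  scalarIdle_pairing β box hbox (fieldIdle_kapply hH (fieldIdle_const cube v σ W))
    (fieldIdle_kapply hΔ (fieldIdle_kapply hH (fieldIdle_const cube w σ W)))

/-- T6's `□`-piece is idle off `W` when `H₁(τ)`, `Δ₁(τ)` are block-local at `W` and `□`'s cubes lie in `W`.
[folklore] -/
theorem scalarIdle_T6loc {cube : Λ → Pt d} (β : M →+ M →+ N) {box : Finset Λ} {σ W : Finset (Pt d)}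
    (hbox : ∀ x ∈ box, cube x ∈ W) {H₁ Δ₁ : (Pt d → ℂ) → Λ → Λ → 𝔸} (hH : BlockLocal cube H₁ σ W)
    (hΔ : BlockLocal cube Δ₁ σ W) (w : Λ → M) : ScalarIdle (T6loc β box H₁ Δ₁ w) σ W :=
  scalarIdle_T5loc β hbox hH hΔ w w

end Linear

/-! ## §3 The `s`-weighted walk model of [II] p. 3 is block-local at the root component -/

section Walks

variable {Ω : Type*} {𝔸 : Type*} [Semiring 𝔸] [Module ℂ 𝔸]

/-- The DECOUPLING WEIGHT of a walk ([II] p. 3: *"we take the {Δ₁, …, Δ_m} of all cubes from σ₀ which intersect this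
localization domain, and we multiply the term in (1.6) corresponding to ω by s(Δ₁)⋯s(Δ_m)"*): the product of the
parameters of the non-root cubes met by the walk (`cubes o` = the M-cubes met by the walk `o`; the cubes of `□̃⁴`,
indices `R`, carry no parameter). [cite: Balaban1988RG2Cluster, p.3 after (1.7)] -/
def weight (R : Finset (Pt d)) (cubes : Ω → Finset (Pt d)) (o : Ω) (τ : Pt d → ℂ) : ℂ :=
  ∏ Δ ∈ cubes o \ R, τ Δ

/-- The `s`-DECORATED WALK SUM `H(s) = Σ_ω s(Δ₁)⋯s(Δ_m)·H_ω` ([II] (1.6)–(1.8) p. 3) over a finite family of walks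
with kernels `ker o`. [cite: Balaban1988RG2Cluster, (1.6)–(1.8) p.3] -/
def walkSum (R : Finset (Pt d)) (walks : Finset Ω) (cubes : Ω → Finset (Pt d)) (ker : Ω → Λ → Λ → 𝔸)
    (τ : Pt d → ℂ) : Λ → Λ → 𝔸 :=
  fun x y => ∑ o ∈ walks, weight R cubes o τ • ker o x y

/-- A walk meeting a cube outside `R ∪ σ` has weight `0` at parameters vanishing off `σ`. [folklore] -/
theorem weight_eq_zero {R σ : Finset (Pt d)} {cubes : Ω → Finset (Pt d)} {o : Ω} {τ : Pt d → ℂ}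
    (hτ : VanishOff σ τ) {Δ : Pt d} (hΔo : Δ ∈ cubes o) (hΔ : Δ ∉ R ∪ σ) : weight R cubes o τ = 0 := by
  unfold weight
  refine Finset.prod_eq_zero (i := Δ) ?_ ?_
  · exact Finset.mem_sdiff.2 ⟨hΔo, fun h => hΔ (Finset.mem_union_left _ h)⟩
  · exact hτ Δ fun h => hΔ (Finset.mem_union_right _ h)

/-- The weight of a walk not meeting the cube `Δ′` does not read the parameter of `Δ′`. [folklore] -/
theorem weight_update_of_not_mem {R : Finset (Pt d)} {cubes : Ω → Finset (Pt d)} {o : Ω} {Δ' : Pt d}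
    (hΔ' : Δ' ∉ cubes o) (τ : Pt d → ℂ) (z : ℂ) :
    weight R cubes o (Function.update τ Δ' z) = weight R cubes o τ := by
  unfold weight
  refine Finset.prod_congr rfl fun Δ hΔ => ?_
  have hne : Δ ≠ Δ' := fun h => hΔ' (h ▸ (Finset.mem_sdiff.1 hΔ).1)
  rw [Function.update_of_ne hne]

/-- A walk of non-zero weight (parameters vanishing off `σ`) whose wall-connected cube family meets `Y₀(σ)` lies
INSIDE `Y₀(σ)`. [folklore] -/
theorem cubes_subset_rootComp {R σ : Finset (Pt d)} {a₀ : Pt d} {cubes : Ω → Finset (Pt d)} {o : Ω}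
    (hconn : WallConnected (↑(cubes o) : Set (Pt d))) {τ : Pt d → ℂ} (hτ : VanishOff σ τ)
    (hw : weight R cubes o τ ≠ 0) {a : Pt d} (ha : a ∈ cubes o) (haY : a ∈ rootComp R σ a₀) :
    cubes o ⊆ rootComp R σ a₀ := by
  refine subset_rootComp_of_wallConnected hconn (fun Δ hΔ => ?_) ha haY
  by_contra hΔY
  exact hw (weight_eq_zero hτ hΔ hΔY)

/-- **THE WALK SUM IS BLOCK-LOCAL AT THE ROOT COMPONENT** — the p. 4 remark DERIVED from the p. 3 definition of the
decoration: for parameters vanishing off `σ`, a walk of non-zero weight meets only cubes of `R ∪ σ`, its cube family is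
wall-connected, hence lies in ONE component of `Y(σ)`; so (i) no entry of `H(s)` joins the root component to its
outside, and (ii) the entries inside the root component come from walks inside it, whose weights do not read the
parameters of the other components. [cite: Balaban1988RG2Cluster, pp.3–4] -/
theorem blockLocal_walkSum (cube : Λ → Pt d) {R : Finset (Pt d)} {a₀ : Pt d} {walks : Finset Ω}
    {cubes : Ω → Finset (Pt d)} {ker : Ω → Λ → Λ → 𝔸}
    (hconn : ∀ o ∈ walks, WallConnected (↑(cubes o) : Set (Pt d)))
    (hsupp : ∀ o ∈ walks, ∀ x y, ker o x y ≠ 0 → cube x ∈ cubes o ∧ cube y ∈ cubes o) (σ : Finset (Pt d)) :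
    BlockLocal cube (walkSum R walks cubes ker) σ (rootComp R σ a₀) where
  off := by
    intro τ hτ x y hx hy
    unfold walkSum
    refine Finset.sum_eq_zero fun o ho => ?_
    by_cases hk : ker o x y = 0
    · rw [hk, smul_zero]
    by_cases hw : weight R cubes o τ = 0
    · rw [hw, zero_smul]
    exact absurd (cubes_subset_rootComp (hconn o ho) hτ hw (hsupp o ho x y hk).1 hx (hsupp o ho x y hk).2) hy
  idle := by
    intro τ hτ Δ' hΔ'σ hΔ'Y z x y hx hy
    unfold walkSum
    refine Finset.sum_congr rfl fun o ho => ?_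
    by_cases hk : ker o x y = 0
    · rw [hk, smul_zero, smul_zero]
    congr 1
    by_cases hsub : cubes o ⊆ R ∪ σ
    · have hY : cubes o ⊆ rootComp R σ a₀ :=
        subset_rootComp_of_wallConnected (hconn o ho) hsub (hsupp o ho x y hk).1 hx
      exact weight_update_of_not_mem (fun h => hΔ'Y (hY h)) τ z
    · obtain ⟨Δ, hΔo, hΔY⟩ := Finset.not_subset.1 hsub
      rw [weight_eq_zero (hτ.update hΔ'σ z) hΔo hΔY, weight_eq_zero hτ hΔo hΔY]

/-- **CONFIGURATION LOCALITY OF THE ROOT BLOCK** ([II] p. 5 ll. 1–3: the `Y₀`-term depends on `𝐔, 𝐉` restricted to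
`Y₀`; p. 3: each walk factor *"depends on external gauge field configurations restricted to the corresponding
domain"*): two kernel assignments (the walk kernels of two configurations) which AGREE on every walk inside the root
component give the same rows of `H(s)` at its sites, at parameters vanishing off `σ`. [cite: Balaban1988RG2Cluster, pp.3–5] -/
theorem walkSum_rootBlock_congr (cube : Λ → Pt d) {R σ : Finset (Pt d)} {a₀ : Pt d} {walks : Finset Ω}
    {cubes : Ω → Finset (Pt d)} {ker ker' : Ω → Λ → Λ → 𝔸}
    (hconn : ∀ o ∈ walks, WallConnected (↑(cubes o) : Set (Pt d)))
    (hsupp : ∀ o ∈ walks, ∀ x y, ker o x y ≠ 0 → cube x ∈ cubes o ∧ cube y ∈ cubes o)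
    (hsupp' : ∀ o ∈ walks, ∀ x y, ker' o x y ≠ 0 → cube x ∈ cubes o ∧ cube y ∈ cubes o)
    (hagree : ∀ o ∈ walks, cubes o ⊆ rootComp R σ a₀ → ker o = ker' o)
    {τ : Pt d → ℂ} (hτ : VanishOff σ τ) {x : Λ} (hx : cube x ∈ rootComp R σ a₀) (y : Λ) :
    walkSum R walks cubes ker τ x y = walkSum R walks cubes ker' τ x y := by
  unfold walkSum
  refine Finset.sum_congr rfl fun o ho => ?_
  by_cases hw : weight R cubes o τ = 0
  · rw [hw, zero_smul, zero_smul]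
  have hsub : cubes o ⊆ R ∪ σ := fun Δ hΔ => by_contra fun hΔY => hw (weight_eq_zero hτ hΔ hΔY)
  by_cases hk : ker o x y = 0 ∧ ker' o x y = 0
  · rw [hk.1, hk.2]
  · have hxo : cube x ∈ cubes o := by
      rcases not_and_or.1 hk with h | h
      · exact (hsupp o ho x y h).1
      · exact (hsupp' o ho x y h).1
    rw [hagree o ho (subset_rootComp_of_wallConnected (hconn o ho) hsub hxo hx)]

end Walks

/-! ## §4 END: the support hypothesis of (1.10) for T3, T5, T6 with walk-decorated propagators, and (1.9) = (1.10) -/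

section End110

variable {E : Type*} {Ω₁ Ω₂ : Type*}

/-- Scalar idleness off the root component, for every live family, IS the support hypothesis of the sibling module.
[folklore] -/
theorem supportedOnRootComp_of_scalarIdle {F : (Pt d → ℂ) → E} {R σ₀ : Finset (Pt d)} {a₀ : Pt d}
    (h : ∀ σ, σ ⊆ σ₀ → ScalarIdle F σ (rootComp R σ a₀)) : SupportedOnRootComp F R σ₀ a₀ :=
  fun σ hσ Δ' hΔ'σ hΔ'Y τ hτ z => h σ hσ τ hτ Δ' hΔ'σ hΔ'Y z

/-- The sites of the anchoring cube `□ ⊂ □̃⁴` lie in the root component of every `Y(σ)`. [folklore] -/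
theorem box_subset_rootComp {cube : Λ → Pt d} {box : Finset Λ} {R : Finset (Pt d)} {a₀ : Pt d}
    (hR : WallConnected (↑R : Set (Pt d))) (ha₀ : a₀ ∈ R) (hbox : ∀ x ∈ box, cube x ∈ R) (σ : Finset (Pt d)) :
    ∀ x ∈ box, cube x ∈ rootComp R σ a₀ :=
  fun x hx => subset_rootComp hR ha₀ σ (hbox x hx)

variable [Fintype Λ] {𝔸 : Type*} [Semiring 𝔸] [Module ℂ 𝔸] {M : Type*} [AddCommMonoid M] [Module 𝔸 M]
  [NormedAddCommGroup E]

/-- **SUPPORT OF T5** ([II] p. 4 ∕ p. 11 «in the same way for all terms in 𝐏^{(k)}», for the term type T5 of [I]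
(2.12)): with both propagators `H₁(s)`, `Δ₁(s)` given by `s`-decorated walk sums and the cube `□` inside `□̃⁴`, the
`□`-piece of T5 at parameters vanishing off `σ` does not depend on the parameters outside the root component
`Y₀(σ)`. [cite: Balaban1988RG2Cluster, p.4 and p.11] -/
theorem supportedOnRootComp_T5loc (cube : Λ → Pt d) (β : M →+ M →+ E) {box : Finset Λ} {R σ₀ : Finset (Pt d)}
    {a₀ : Pt d} (hR : WallConnected (↑R : Set (Pt d))) (ha₀ : a₀ ∈ R) (hbox : ∀ x ∈ box, cube x ∈ R)
    {walks₁ : Finset Ω₁} {cubes₁ : Ω₁ → Finset (Pt d)} {ker₁ : Ω₁ → Λ → Λ → 𝔸}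
    (hconn₁ : ∀ o ∈ walks₁, WallConnected (↑(cubes₁ o) : Set (Pt d)))
    (hsupp₁ : ∀ o ∈ walks₁, ∀ x y, ker₁ o x y ≠ 0 → cube x ∈ cubes₁ o ∧ cube y ∈ cubes₁ o)
    {walks₂ : Finset Ω₂} {cubes₂ : Ω₂ → Finset (Pt d)} {ker₂ : Ω₂ → Λ → Λ → 𝔸}
    (hconn₂ : ∀ o ∈ walks₂, WallConnected (↑(cubes₂ o) : Set (Pt d)))
    (hsupp₂ : ∀ o ∈ walks₂, ∀ x y, ker₂ o x y ≠ 0 → cube x ∈ cubes₂ o ∧ cube y ∈ cubes₂ o) (v w : Λ → M) :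
    SupportedOnRootComp (T5loc β box (walkSum R walks₁ cubes₁ ker₁) (walkSum R walks₂ cubes₂ ker₂) v w) R σ₀ a₀ :=
  supportedOnRootComp_of_scalarIdle fun σ _ =>
    scalarIdle_T5loc β (box_subset_rootComp hR ha₀ hbox σ) (blockLocal_walkSum cube hconn₁ hsupp₁ σ)
      (blockLocal_walkSum cube hconn₂ hsupp₂ σ) v w

/-- SUPPORT OF T3 (only `H₁(s)` is decorated; `u = hD̃₃(g_kCB)` and `J` are not). [cite: Balaban1988RG2Cluster, p.4 and p.11] -/
theorem supportedOnRootComp_T3loc (cube : Λ → Pt d) (β : M →+ M →+ E) {box : Finset Λ} {R σ₀ : Finset (Pt d)}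
    {a₀ : Pt d} (hR : WallConnected (↑R : Set (Pt d))) (ha₀ : a₀ ∈ R) (hbox : ∀ x ∈ box, cube x ∈ R)
    {walks₁ : Finset Ω₁} {cubes₁ : Ω₁ → Finset (Pt d)} {ker₁ : Ω₁ → Λ → Λ → 𝔸}
    (hconn₁ : ∀ o ∈ walks₁, WallConnected (↑(cubes₁ o) : Set (Pt d)))
    (hsupp₁ : ∀ o ∈ walks₁, ∀ x y, ker₁ o x y ≠ 0 → cube x ∈ cubes₁ o ∧ cube y ∈ cubes₁ o) (u J : Λ → M) :
    SupportedOnRootComp (T3loc β box (walkSum R walks₁ cubes₁ ker₁) u J) R σ₀ a₀ :=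
  supportedOnRootComp_of_scalarIdle fun σ _ =>
    scalarIdle_T3loc β (box_subset_rootComp hR ha₀ hbox σ) (blockLocal_walkSum cube hconn₁ hsupp₁ σ) u J

/-- SUPPORT OF T6 (both propagators decorated; `w = hD̃(g_kCB)` twice). [cite: Balaban1988RG2Cluster, p.4 and p.11] -/
theorem supportedOnRootComp_T6loc (cube : Λ → Pt d) (β : M →+ M →+ E) {box : Finset Λ} {R σ₀ : Finset (Pt d)}
    {a₀ : Pt d} (hR : WallConnected (↑R : Set (Pt d))) (ha₀ : a₀ ∈ R) (hbox : ∀ x ∈ box, cube x ∈ R)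
    {walks₁ : Finset Ω₁} {cubes₁ : Ω₁ → Finset (Pt d)} {ker₁ : Ω₁ → Λ → Λ → 𝔸}
    (hconn₁ : ∀ o ∈ walks₁, WallConnected (↑(cubes₁ o) : Set (Pt d)))
    (hsupp₁ : ∀ o ∈ walks₁, ∀ x y, ker₁ o x y ≠ 0 → cube x ∈ cubes₁ o ∧ cube y ∈ cubes₁ o)
    {walks₂ : Finset Ω₂} {cubes₂ : Ω₂ → Finset (Pt d)} {ker₂ : Ω₂ → Λ → Λ → 𝔸}
    (hconn₂ : ∀ o ∈ walks₂, WallConnected (↑(cubes₂ o) : Set (Pt d)))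
    (hsupp₂ : ∀ o ∈ walks₂, ∀ x y, ker₂ o x y ≠ 0 → cube x ∈ cubes₂ o ∧ cube y ∈ cubes₂ o) (w : Λ → M) :
    SupportedOnRootComp (T6loc β box (walkSum R walks₁ cubes₁ ker₁) (walkSum R walks₂ cubes₂ ker₂) w) R σ₀ a₀ :=
  supportedOnRootComp_T5loc cube β hR ha₀ hbox hconn₁ hsupp₁ hconn₂ hsupp₂ w w

open Classical in
/-- **(1.9) = (1.10) FOR T5** (kernel END, composition with the sibling module's `sum_term19_eq_sum_connected`): for
the `□`-piece of T5 with walk-decorated propagators, the decoupling expansion (1.9) in the representation (1.23) is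
a sum over the CONNECTED domains `Y₀ = □̃⁴ ∪ ⋃σ` only. [cite: Balaban1988RG2Cluster, (1.10) p.4 and p.11] -/
theorem sum_term19_T5loc_eq_sum_connected [NormedSpace ℂ E] [CompleteSpace E] (ρ : ℝ) (cube : Λ → Pt d) (β : M →+ M →+ E)
    {box : Finset Λ} {R σ₀ : Finset (Pt d)} {a₀ : Pt d} (hR : WallConnected (↑R : Set (Pt d))) (ha₀ : a₀ ∈ R)
    (hbox : ∀ x ∈ box, cube x ∈ R)
    {walks₁ : Finset Ω₁} {cubes₁ : Ω₁ → Finset (Pt d)} {ker₁ : Ω₁ → Λ → Λ → 𝔸}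
    (hconn₁ : ∀ o ∈ walks₁, WallConnected (↑(cubes₁ o) : Set (Pt d)))
    (hsupp₁ : ∀ o ∈ walks₁, ∀ x y, ker₁ o x y ≠ 0 → cube x ∈ cubes₁ o ∧ cube y ∈ cubes₁ o)
    {walks₂ : Finset Ω₂} {cubes₂ : Ω₂ → Finset (Pt d)} {ker₂ : Ω₂ → Λ → Λ → 𝔸}
    (hconn₂ : ∀ o ∈ walks₂, WallConnected (↑(cubes₂ o) : Set (Pt d)))
    (hsupp₂ : ∀ o ∈ walks₂, ∀ x y, ker₂ o x y ≠ 0 → cube x ∈ cubes₂ o ∧ cube y ∈ cubes₂ o) (v w : Λ → M) :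
    ∑ σ ∈ σ₀.powerset, term19 ρ (T5loc β box (walkSum R walks₁ cubes₁ ker₁) (walkSum R walks₂ cubes₂ ker₂) v w) σ
      = ∑ σ ∈ σ₀.powerset with WallConnected (↑(R ∪ σ) : Set (Pt d)),
          term19 ρ (T5loc β box (walkSum R walks₁ cubes₁ ker₁) (walkSum R walks₂ cubes₂ ker₂) v w) σ :=
  sum_term19_eq_sum_connected ρ hR ha₀
    (supportedOnRootComp_T5loc cube β hR ha₀ hbox hconn₁ hsupp₁ hconn₂ hsupp₂ v w)

end End110

end

end Summit.QuantumFields.BalabanUV.Beta.DecouplingSupport110
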